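import Summits.BirchSwinnertonDyer.Rank1Residual.F1Sign2.TranspositionDoorAtTwo
import Literature.NumberTheory.EllipticCurves.ModularCurve
import HarnessLib
import Literature.NumberTheory.EllipticCurves.GaloisAction
import Summits.BirchSwinnertonDyer.Rank1Residual.F1Sign2.WildPacketAtTwo

/-!
# Cell `bsd-f1-sign2`, lens `-an` g24 — AN-41 THE KUMMER CLASS AS A MODULAR FIRST-ORDER DEFORMATION AT `2`
# (sketch; statements only; nothing here proves BSD; crux 23715 not closed)

THE `p = 2` ACCIDENT.  For `ρ̄ = ρ̄_{E,2} : G_ℚ ↠ GL₂(𝔽₂) ≅ S₃` the trace-zero matrices split AS A GALOIS MODULE: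
`sl₂(𝔽₂) = 𝔽₂·I ⊕ V`, `V = {0, τ₁, τ₂, τ₃}` = zero together with the three involutions (= transvections) of `GL₂(𝔽₂)`,
and `v ↦ τ_v` (the transvection fixing `v`, `0 ↦ 0`) is a `G_ℚ`-LINEAR isomorphism `E[2] ≅ V` (kernel lemmas K41.1–3 below,
`decide`).  Hence two lifts `ρ, ρ' : G_ℚ → GL₂(ℤ/4)` of the same `ρ̄` differ by `ρ' = (1 + 2(h·I + τ_c))ρ` with
`h ∈ Hom(G_ℚ, 𝔽₂)` (a quadratic character: `1 + 2h = χ_D (mod 4)`) and `c ∈ Z¹(G_ℚ, E[2])`, and (K41.2)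
  **`a_ℓ(E') − a_ℓ(E) ≡ 2·( h(ℓ)·a_ℓ(E) + t_c(ℓ) ) (mod 4)`**,  `t_c(ℓ) = [ρ̄(Frob_ℓ) is an involution τ_w and c(Frob_ℓ) ∉ {0,w}]`
`= [Frob_ℓ is a 4-cycle in the S₄-extension cut out by c]` (`0` at split and at `3`-cycle primes; a class function of `[c]`).
For the KUMMER class `c = κ_P` of `P ∈ E(ℚ)`: `t_P(ℓ) = [Frob_ℓ transposition on E[2] ∧ P mod ℓ ∉ 2Ẽ(𝔽_ℓ)]` — the Kummer
line bit of MEMO-an §26 (AN-40), now generator-wise.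
AN-41a (CONJECTURE, the mechanism): the first-order deformation `ρ̄ ⊗ (1 + ε τ_{κ_P})` IS MODULAR OF LEVEL `4N` over `𝔽₂[ε]`:
there are a nonzero old-vector `v ∈ ⟨f̄_E, f̄_E|V₂, f̄_E|V₄⟩` and an integral weight-2 cusp form `G` on `Γ₀(4N)` with
`(T_ℓ − a_ℓ) G ≡ t_P(ℓ)·v (mod 2)` for all `ℓ ∤ 2N` (first typing `v = f̄_E` falsified on `a₂`-odd curves by census K1).
Census (kit K1, PARI `mfinit([4N,2,1],0)` + `mfheckemat`, exact linear algebra over `𝔽₂`, 43 prime levels `N < 700`): the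
generalized `𝔽₂`-eigenspace of `𝕋(4N)` at `𝔪_E` realizes EVERY tested Kummer direction `κ_P`, `P ∈ E(ℚ)`, of every curve of rank
`≥ 1` (37/37, 0 misfits; rank 2 included) — with multiplicity `3` (on `f̄, f̄|V₂, f̄|V₄`) when `a₂` is even and once (on
`f̄ + f̄|V₂`) when `a₂` is odd — next to the universal scalar direction `h₄·ā` (`χ₋₄`) and directions cut out by OTHER newforms
congruent to `f_E`; at the 8 rank-0 systems without congruences only `h₄·ā` occurs (MEMO-an §27.4); the Kohnen–θ transport `Ĝ = g̃θ` of §26 lies in socle layer 2–3 of the same module and reads the same `t_P`.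
AN-41b (THEOREM-CANDIDATE, pure Galois theory mod 4 + K41): congruent curves' digit differences are `χ_D`-twist plus a 4-cycle bit.
AN-41c (CONJECTURE, census 26/26 congruent optimal pairs of equal prime conductor `N < 5000`): the scalar character is `1` or `χ₋₄`
(never `χ_{±8}`, `χ_{±N}`), i.e. on `a_ℓ`-odd primes `a_ℓ(E') ≡ a_ℓ(E)` for all `ℓ` or `a_ℓ(E') ≡ χ₋₄(ℓ) a_ℓ(E)` for all `ℓ` (mod 4).
Nearest print: Dummigan, JTNB 18 (2006) 345–355 (squaring map `Sel₂(E) → H¹(ℚ, Sym²E[2])`, tangent space of the 2-adic deformation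
ring, Watkins' `2^r ∣ deg φ`); Calegari–Emerton, arXiv:math/0503359 Thm 1.1 (`𝕋_𝔪 ≠ ℤ₂` via explicit `𝔽₂[x]/(x²)`-deformations,
"in certain situations"); neither has the digit formula, the level-`4N` multiplicity-three realization, or the weight-3/2 reading.
-/

namespace Summit.BirchSwinnertonDyer.Rank1Residual.F1Sign2.ANg24

open Literature.NumberTheory.EllipticCurves Literature.NumberTheory.EllipticCurves.ModularForms UpperHalfPlane
open Summit.BirchSwinnertonDyer.Rank1Residual.F1Sign2
open Summit.BirchSwinnertonDyer.Rank1Residual.F1Sign2.TranspositionDoor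
open scoped ModularForm
open CongruenceSubgroup

/-! ### §41.0 Kernel lemmas: `sl₂(𝔽₂) = 𝔽₂ ⊕ E[2]` and the digit trace formula (decidable, `Fin 2`, `ZMod 2`) -/

/-- The symplectic (Weil) form on `𝔽₂²`: `⟪v, w⟫ = v₀w₁ + v₁w₀ = det(v | w)`. -/
def weil (v w : Fin 2 → ZMod 2) : ZMod 2 := v 0 * w 1 + v 1 * w 0

/-- `ι v` = the transvection `w ↦ w + ⟪v,w⟫ v` fixing `v` for `v ≠ 0`, and `ι 0 = 0`:  the `G`-linear map `E[2] → sl₂(𝔽₂)`. -/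
def iota (v : Fin 2 → ZMod 2) : Matrix (Fin 2) (Fin 2) (ZMod 2) :=
  fun i j => (if v = 0 then 0 else if i = j then 1 else 0) + v i * v (1 - j)

/-- K41.1 (additivity): `ι (v + w) = ι v + ι w` — `{0, τ₁, τ₂, τ₃}` is a subspace and `v ↦ τ_v` is linear. -/
theorem iota_add : ∀ v w : Fin 2 → ZMod 2, iota (v + w) = iota v + iota w := by decide

/-- K41.1' (equivariance): `g (ι v) g⁻¹ = ι (g v)` for every `g ∈ GL₂(𝔽₂)` (stated as `g ι(v) = ι(g v) g` over all invertible `g`). -/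
theorem iota_conj : ∀ (g : Matrix (Fin 2) (Fin 2) (ZMod 2)) (v : Fin 2 → ZMod 2), g.det ≠ 0 →
    g * iota v = iota (g.mulVec v) * g := by decide

/-- K41.1'' (complement): every trace-zero matrix is uniquely `h•1 + ι v`; with K41.1/1' this is `sl₂(𝔽₂) ≅ 𝔽₂ ⊕ E[2]` as
`GL₂(𝔽₂)`-modules. -/
theorem sl2_decomp : ∀ M : Matrix (Fin 2) (Fin 2) (ZMod 2), M.trace = 0 →
    ∃ h : ZMod 2, ∃ v : Fin 2 → ZMod 2, M = h • (1 : Matrix (Fin 2) (Fin 2) (ZMod 2)) + iota v := by decide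

/-- K41.1''' (directness): `h•1 + ι v = 0` only for `h = 0, v = 0`. -/
theorem sl2_direct : ∀ (h : ZMod 2) (v : Fin 2 → ZMod 2),
    h • (1 : Matrix (Fin 2) (Fin 2) (ZMod 2)) + iota v = 0 → h = 0 ∧ v = 0 := by decide

/-- K41.2 (the digit trace formula): for `g ∈ GL₂(𝔽₂)` and `v`, `tr(ι(v)·g) = [g is an involution and g v ≠ v]`
(`= 0` when `g = 1`, when `g` has order `3`, and when `g` is the involution fixing `v`).  With `ρ' = (1 + 2(hI + ι∘c))ρ`:
`tr ρ'(F) − tr ρ(F) ≡ 2(h(F)·tr ρ̄(F) + tr(ι(c F) ρ̄(F))) (mod 4)`. -/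
theorem trace_iota_mul : ∀ (g : Matrix (Fin 2) (Fin 2) (ZMod 2)) (v : Fin 2 → ZMod 2), g.det ≠ 0 →
    (iota v * g).trace = (if g * g = 1 ∧ g ≠ 1 ∧ g.mulVec v ≠ v then 1 else 0) := by decide

/-- K41.3 (class function): the bit `[g involution ∧ g v ≠ v]` only depends on `v` modulo `(g − 1)𝔽₂²` — so `t_c(Frob)` is
well defined on the cohomology class of `c`. -/
theorem bit_coboundary : ∀ (g : Matrix (Fin 2) (Fin 2) (ZMod 2)) (v u : Fin 2 → ZMod 2), g.det ≠ 0 → g * g = 1 →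
    (g.mulVec (v + (g.mulVec u - u)) ≠ v + (g.mulVec u - u) ↔ g.mulVec v ≠ v) := by decide

open scoped Classical

/-! ### §41.1 The point Kummer bit and AN-41a -/

/-- **Point Kummer bit** of `P ∈ E(ℚ)` at an odd prime `p`: Frobenius at `p` is a TRANSPOSITION on `E[2]` (`(Δ/p) = −1`, one
root of the 2-division cubic) AND `P mod p ∉ 2Ẽ(𝔽_p)` (tree `reducePointAt`); equivalently `Frob_p` is a `4`-cycle in
`Gal(ℚ(E[2], ½P)/ℚ) ↪ S₄`; `= t_{κ_P}(p)` of K41.2.  (At `p` of bad reduction the value is junk; the laws exclude `p ∣ 2N`.) -/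
def PointKummerBitAt (W : WeierstrassCurve ℚ) [W.IsIntegral ℤ] (P : W.toAffine.Point) (p : ℕ) : Prop :=
  ∃ hp : p.Prime, jacobiSym W.Δ.num p = -1 ∧
    ∀ Q : (@reductionAtPrime W _ p ⟨hp⟩).toAffine.Point, @reducePointAt W _ p ⟨hp⟩ P ≠ 2 • Q

/-- The point Kummer bit as an integer `0/1`. -/
noncomputable def pointKummerBit (W : WeierstrassCurve ℚ) [W.IsIntegral ℤ] (P : W.toAffine.Point) (p : ℕ) : ℤ :=
  if PointKummerBitAt W P p then 1 else 0

/-- The mod-2 HECKE DEFECT `(T_ℓ − a_ℓ) z` on integer sequences (exact modulo `2` for odd `ℓ`; copy of -an g23's `heckeDefect`):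
`(θ_ℓ z)(n) = z(ℓn) + [ℓ ∣ n] z(n/ℓ) + a_ℓ z(n)`. -/
def heckeDefect (a : ℕ → ℤ) (ℓ : ℕ) (z : ℕ → ℤ) : ℕ → ℤ :=
  fun n => z (ℓ * n) + (if ℓ ∣ n then z (n / ℓ) else 0) + a ℓ * z n

/-- **AN-41a `KummerDeformationModularAtLevelFourN` (CONJECTURE of this lens — the mechanism behind AN-40).**
`E/ℚ` of PRIME conductor `N` with surjective mod-`2` image, `P ∈ E(ℚ)` ANY rational point.  Then the first-order deformation of
`ρ̄_{E,2}` along the Kummer class `κ_P ∈ H¹(ℚ, E[2])` is MODULAR OF LEVEL `4N`: there are a nonzero old-vector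
`v = ε₁ f̄ + ε₂ f̄|V₂ + ε₄ f̄|V₄` (`εᵢ ∈ {0,1}`, not all `0`) and a weight-`2` cusp form `G` on `Γ₀(4N)` with integer
`q`-coefficients `z` such that for every prime `ℓ ∤ 2N` and `n ≥ 1`
  `(T_ℓ − a_ℓ) z (n) ≡ t_P(ℓ) · (ε₁ a_n + ε₂ a_{n/2} + ε₄ a_{n/4}) (mod 2)`,
i.e. `v + ε Ḡ` is a `𝕋(4N)`-eigenform over `𝔽₂[ε]` with `T_ℓ ↦ a_ℓ + ε t_P(ℓ)` (`t_P` = the point Kummer bit = K41.2's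
`t_{κ_P}`).  (`P ∈ 2E(ℚ) + E(ℚ)_{tors}` ⇒ `t_P ≡ 0`, witness `G = 0`; the content is at `P ∉ 2E(ℚ)`.)  FIRST TYPING (target
`v = f̄` only) was FALSIFIED by census K1 on the `a₂`-odd curves (53a1, 61a1, 79a1, 83a1, 89a1, …: `t_P` is realized on
`f̄ + f̄|V₂`, not on `f̄`); on `a₂`-even curves it is realized on each of `f̄, f̄|V₂, f̄|V₄`.  Census K1 (kit j332386, exact linear
algebra over `𝔽₂`, 43 prime `N < 700`, all `51` mod-2 eigensystems): `37/37` Kummer directions of the `33` curves of rank `≥ 1`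
realized in their own generalized eigenspace with `0` misfits (`ℓ ≤ 250`, `n ≤ 24`; rank-2 levels 389, 433 with all three
nonzero classes of `E(ℚ)/2E(ℚ)`, 563, 571, 643 with one generator), `6/6` non-congruent cross-controls NOT realized (10–31 misfits).  Why it might
fail: a level with `Ш(E)[2] ≠ 0` or a non-Gorenstein `𝕋(4N)_𝔪` where the Kummer direction needs level `8N` or `16N`; rank
`≥ 2` beyond `N < 700`.  [cite: Dummigan2006, §2–3] [cite: CalegariEmerton2005, Thm. 1.1] -/
def KummerDeformationModularAtLevelFourN : Prop :=
  ∀ (W : WeierstrassCurve ℚ) [W.IsElliptic] [W.IsGloballyMinimal] [W.IsIntegral ℤ] [NeZero (W.conductorNorm ℤ)],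
    (W.conductorNorm ℤ).Prime → W.HasSurjectiveModNGaloisRep 2 →
    ∀ P : W.toAffine.Point,
      ∃ (G : CuspForm (Gamma0 (4 * W.conductorNorm ℤ)) 2) (z : ℕ → ℤ) (e₁ e₂ e₄ : ℤ),
        ¬ (Even e₁ ∧ Even e₂ ∧ Even e₄) ∧
        (∀ n : ℕ, cuspCoeff G n = (z n : ℂ)) ∧
        ∀ ℓ : ℕ, ℓ.Prime → ℓ ≠ 2 → ℓ ≠ W.conductorNorm ℤ →
          ∀ n : ℕ, 0 < n →
            Even (heckeDefect (fun m => W.LFunction m) ℓ z n - pointKummerBit W P ℓ *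
              (e₁ * W.LFunction n + e₂ * (if 2 ∣ n then W.LFunction (n / 2) else 0) +
                e₄ * (if 4 ∣ n then W.LFunction (n / 4) else 0)))

/-! ### §41.2 AN-41b — the digit law for congruent curves (THEOREM-CANDIDATE) -/

/-- **AN-41b `CongruentCurvesDigitLawAtTwo` (THEOREM-CANDIDATE: Galois representations mod `4` + K41.1–3 + the quartic /
cubic-resolvent dictionary).**  `E, E'/ℚ` with `ρ̄_{E,2}` surjective and `a_ℓ(E) ≡ a_ℓ(E') (mod 2)` at all common good odd primes.
Then there are a nonzero integer `D`, a monic integer quartic `g` and a finite exceptional set `S` of primes such that for every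
prime `ℓ ∉ S`:
  `a_ℓ(E') − a_ℓ(E) ≡ 2·( [a_ℓ(E) odd]·[(D/ℓ) = −1] + [g irreducible mod ℓ] ) (mod 4)`.
(`D` ↔ the scalar part `h`, `1 + 2h = χ_D`; `g` ↔ the `E[2]`-part `c`: the `S₄`-quartic with cubic resolvent `ℚ(E[2])` cut out
by `c`, irreducible mod `ℓ` iff `Frob_ℓ` is a `4`-cycle; `c = 0` ↦ any `g` reducible mod every `ℓ`, e.g. `X²(X−1)²`.)
Why it might fail: only through the typing (junk `frobeniusTrace` at bad primes is excluded by `S`); mathematically it is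
K41 + `ρ_{E',4} ≡ (1 + 2d)ρ_{E,4}` + Chebotarev-free pointwise trace comparison; `ρ̄_E ≅ ρ̄_{E'}` follows from the mod-2
congruence because an `S₃`-cubic field is determined by its inert primes.  Census: 26/26 congruent optimal pairs of prime
conductor `< 5000`, `p ≤ 700…2500`, explicit `(D, c)` (MEMO-an §27.3). [cite: Dummigan2006, §2] -/
def CongruentCurvesDigitLawAtTwo : Prop :=
  ∀ (W W' : WeierstrassCurve ℚ) [W.IsElliptic] [W'.IsElliptic] [W.IsGloballyMinimal] [W'.IsGloballyMinimal]
    [W.IsIntegral ℤ] [W'.IsIntegral ℤ],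
    W.HasSurjectiveModNGaloisRep 2 →
    (∀ ℓ : ℕ, ∀ _h : Fact ℓ.Prime, ℓ ≠ 2 → W.HasGoodReductionAtPrime ℓ → W'.HasGoodReductionAtPrime ℓ →
        Even (W.frobeniusTrace ℓ - W'.frobeniusTrace ℓ)) →
    ∃ (D : ℤ) (g : Polynomial ℤ) (S : Finset ℕ), D ≠ 0 ∧ g.Monic ∧ g.natDegree = 4 ∧
      ∀ ℓ : ℕ, ℓ.Prime → ℓ ∉ S →
        (4 : ℤ) ∣ W'.frobeniusTrace ℓ - W.frobeniusTrace ℓ -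
          2 * ((if Odd (W.frobeniusTrace ℓ) ∧ jacobiSym D ℓ = -1 then 1 else 0) +
               (if Irreducible (g.map (Int.castRingHom (ZMod ℓ))) then 1 else 0))

/-! ### §41.3 AN-41c — the prime-level scalar law (CONJECTURE; census 26/26) -/

/-- **AN-41c `PrimeLevelScalarDigitLawAtTwo` (CONJECTURE; census of ALL 26 congruent pairs of optimal curves of equal PRIME
conductor `N < 5000`).**  If `E, E'` are elliptic curves of the same prime conductor `N`, `ρ̄_{E,2}` surjective, congruent mod `2`,
then the scalar character of AN-41b is `1` or `χ₋₄` MODULO THE INVISIBLE `χ_{N*}` (`N* = ±N` the discriminant kernel field: `χ_{N*} = +1` at every `a_ℓ`-odd prime, so `χ_D` and `χ_{DN*}` give the same law) — never `χ_{±8}·(…)`: EITHER `a_ℓ(E') ≡ a_ℓ(E) (mod 4)` at every good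
odd prime with `a_ℓ(E)` odd, OR `a_ℓ(E') ≡ χ₋₄(ℓ)·a_ℓ(E) (mod 4)` at every such prime.  (`χ_{±8}` is excluded conjecturally by finite flatness at `2` of both `ρ_{E,4}`, `ρ_{E',4}` — the `p = 2` subtlety; -es §30 (L-ss-iii) proves `D ≡ 1 (mod 4)` when BOTH are supersingular at `2`; census: `13` pairs with `h = 0`, `13` with `h = h₄`,
`0` other, `0` exceptions at `p ≤ 700`.)  Why it might fail: a pair at larger `N` whose `2`-adic local types at `2` differ by
`χ₈ (mod 4)`; non-optimal members of the isogeny class are not excluded here (isogenies are odd-degree under surjectivity, fine). -/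
def PrimeLevelScalarDigitLawAtTwo : Prop :=
  ∀ (W W' : WeierstrassCurve ℚ) [W.IsElliptic] [W'.IsElliptic] [W.IsGloballyMinimal] [W'.IsGloballyMinimal]
    [W.IsIntegral ℤ] [W'.IsIntegral ℤ] [NeZero (W.conductorNorm ℤ)] [NeZero (W'.conductorNorm ℤ)],
    (W.conductorNorm ℤ).Prime → W'.conductorNorm ℤ = W.conductorNorm ℤ → W.HasSurjectiveModNGaloisRep 2 →
    (∀ ℓ : ℕ, ∀ _h : Fact ℓ.Prime, ℓ ≠ 2 → ℓ ≠ W.conductorNorm ℤ → Even (W.frobeniusTrace ℓ - W'.frobeniusTrace ℓ)) →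
    (∀ ℓ : ℕ, ∀ _h : Fact ℓ.Prime, ℓ ≠ 2 → ℓ ≠ W.conductorNorm ℤ → Odd (W.frobeniusTrace ℓ) →
        (4 : ℤ) ∣ W'.frobeniusTrace ℓ - W.frobeniusTrace ℓ) ∨
    (∀ ℓ : ℕ, ∀ _h : Fact ℓ.Prime, ℓ ≠ 2 → ℓ ≠ W.conductorNorm ℤ → Odd (W.frobeniusTrace ℓ) →
        (4 : ℤ) ∣ W'.frobeniusTrace ℓ - (if ℓ % 4 = 3 then -1 else 1) * W.frobeniusTrace ℓ)

/-! ## AN-42 — THE OCTAHEDRAL AVATAR (g24, second half).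
`Gal(ℚ(E[2], ½P)/ℚ) ≅ S₄ ≅ PGL₂(𝔽₃)`.  Kernel theorem K42 (file `OctahedralDigitLawK42.lean`, all `decide`): in the (unique up to
homothety) stable `ℤ₂[√−2]`-lattice of the faithful 2-dimensional representation of `GL₂(𝔽₃) ≅ 2·S₄`, reduction MODULO `2 = −(√−2)²`
has image `S₄ ⊂ GL₂(𝔽₂[ε])` (`ε = √−2 mod 2`), equal to `ρ̄ ⊗ (1 + ε·τ_c)` with `c` the tautological `V₄ ≅ E[2]` cocycle, and
`tr(g) ≡ [g ↦ 3-cycle] + ε·[g ↦ 4-cycle] (mod 2)`.  Hence (AN-42a) whenever the embedding problem `S₄ → GL₂(𝔽₃)` for `ℚ(E[2],½P)` is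
solvable (Serre 1984, Thm 1: `w₂(Tr x²) + (2)(d) = 0`), the Kummer deformation `ρ̄ ⊗ (1 + ε τ_{κ_P})` IS the mod-2 reduction of an
Artin representation `ρ_P : G_ℚ → GL₂(ℤ[√−2])`, `tr ρ_P(Frob_ℓ) ≡ a_ℓ(E) + √−2·t_P(ℓ) (mod 2)`; (AN-42b) if moreover `Δ_E < 0`
(complex conjugation = transposition ⇒ `ρ_P` odd) then by Langlands–Tunnell `ρ_P` is the representation of an octahedral
weight-ONE newform `h_P = Σ (u_n + v_n √−2) qⁿ` and **`v_ℓ ≡ t_P(ℓ) (mod 2)`**: the Heegner-index-parity slot `s` of §26 is the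
`√−2`-digit of a weight-one form.  Census K42b (122 rank ≥ 1 prime-conductor curves, `N < 5000`, exact Hilbert-symbol arithmetic):
local obstructions `e_∞ = −1 ⟺ P ∉ E⁰(ℝ)` (41/41), `e_N = −1 ⟺ P ∉ 2E(ℚ_N)` (89/89 curves with local rows), `E` supersingular at `2 ⇒
e₂ = +1` (61/61); for `Δ_E < 0` the problem is unobstructed iff `P ∈ 2E(ℚ_N)` (46 of 74).  AN-42d below is the reciprocity these force. -/

/-- The `2`-division ("halving") quartic of the abscissa `x₀` is solvable over the `ℚ`-algebra `K`
(`K = ℝ`: `P ∈ 2E(ℝ) = E⁰(ℝ)`; `K = ℚ_N`: `P ∈ 2E(ℚ_N)`, for `P = (x₀, y₀)` of infinite order; cf. `WildPacket.TwoDivisionQuarticSolvableAtTwo`). -/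
def HalvingQuarticSolvableOver (K : Type*) [Field K] [Algebra ℚ K] (W : WeierstrassCurve ℚ) (x₀ : ℚ) : Prop :=
  ∃ t : K, 4 * t ^ 3 + algebraMap ℚ K W.b₂ * t ^ 2 + 2 * algebraMap ℚ K W.b₄ * t + algebraMap ℚ K W.b₆ ≠ 0 ∧
    t ^ 4 - algebraMap ℚ K W.b₄ * t ^ 2 - 2 * algebraMap ℚ K W.b₆ * t - algebraMap ℚ K W.b₈ =
      algebraMap ℚ K x₀ * (4 * t ^ 3 + algebraMap ℚ K W.b₂ * t ^ 2 + 2 * algebraMap ℚ K W.b₄ * t + algebraMap ℚ K W.b₆)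

/-- **AN-42b (THEOREM-CANDIDATE modulo writing: K42 + Serre 1984 Thm 1 + Tunnell 1981 + the census-identified local law at `N`;
kit test K42c pending).**  `N` prime, `ρ̄_{E,2}` onto, `Δ_E < 0`, `P = (x,y) ∈ E(ℚ)` of infinite order with `P ∈ 2E(ℚ_N)`: there is a
weight-one cusp form `F` of some level `M`, `2N ∣ M`, with `q`-expansion `Σ (uₙ + vₙ√−2) qⁿ`, `u₁ = 1`, such that for every prime
`ℓ ∤ M`: `u_ℓ ≡ a_ℓ(E)` and `v_ℓ ≡ t_P(ℓ)` (mod 2) — the OCTAHEDRAL WEIGHT-ONE AVATAR of the Kummer deformation. -/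
def OctahedralWeightOneAvatarAtTwo : Prop :=
  ∀ (W : WeierstrassCurve ℚ) [W.IsElliptic] [W.IsGloballyMinimal] [W.IsIntegral ℤ] [NeZero (W.conductorNorm ℤ)]
    (N : ℕ) [Fact N.Prime], W.conductorNorm ℤ = N → W.HasSurjectiveModNGaloisRep 2 → W.Δ < 0 →
    ∀ (x y : ℚ) (h : W.toAffine.Nonsingular x y), ¬ IsOfFinAddOrder (WeierstrassCurve.Affine.Point.some _ _ h) →
      HalvingQuarticSolvableOver ℚ_[N] W x →
      ∃ (M : ℕ) (F : CuspForm (Gamma1 M) 1) (u v : ℕ → ℤ), 2 * N ∣ M ∧ u 1 = 1 ∧ v 1 = 0 ∧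
        (∀ n : ℕ, cuspCoeff F n = (u n : ℂ) + (v n : ℂ) * (Complex.I * (Real.sqrt 2 : ℂ))) ∧
        ∀ ℓ : ℕ, ℓ.Prime → ¬ ℓ ∣ M →
          Even (u ℓ - W.LFunction ℓ) ∧ Even (v ℓ - pointKummerBit W (WeierstrassCurve.Affine.Point.some _ _ h) ℓ)

/-- **AN-42d (CONJECTURE → theorem-candidate: SUPERSINGULAR HALVING RECIPROCITY; census K42b 45/45 with local rows, 61/61 for
`e₂ = +1`).**  `N` prime, `E` supersingular at `2` (`a₂` even), `ρ̄_{E,2}` onto: a rational point of infinite order lies on the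
identity component `E⁰(ℝ) = 2E(ℝ)` iff it is `2`-divisible in `E(ℚ_N)`.  (Hilbert reciprocity for Serre's class `w₂(Tr x²)+(2)(d)` of
the halving field, given the three local laws; for `Δ_E < 0` it says `E(ℚ) ⊂ 2E(ℚ_N) + E(ℚ)_{tors}`.) -/
def SupersingularHalvingReciprocity : Prop :=
  ∀ (W : WeierstrassCurve ℚ) [W.IsElliptic] [W.IsGloballyMinimal] [W.IsIntegral ℤ] [NeZero (W.conductorNorm ℤ)]
    (N : ℕ) [Fact N.Prime], W.conductorNorm ℤ = N → W.HasSurjectiveModNGaloisRep 2 → Even (W.LFunction 2) →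
    ∀ (x y : ℚ) (h : W.toAffine.Nonsingular x y), ¬ IsOfFinAddOrder (WeierstrassCurve.Affine.Point.some _ _ h) →
      (HalvingQuarticSolvableOver ℝ W x ↔ HalvingQuarticSolvableOver ℚ_[N] W x)


/-- **AN-42d′ (THEOREM-CANDIDATE, g24 MEMO-an §27.11 — complete proof sketch: product formula for Serre's class
`w₂(Tr x²) + (2)∪(d)` of the halving field `ℚ(E[2], ½P)` (an `S₄`-field by `ρ̄` onto), plus three local laws:
`L_∞` (a double transposition has no involution lift to `GL₂(𝔽₃)`: `inv_∞ ≠ 0 ↔ P ∉ E⁰(ℝ)`), `L_N` (`v_N(Δ)` odd ⇒ the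
decomposition group at `N` sits in `C₂ × C₂` with transposition inertia; `inv_N ≠ 0 ↔ P ∉ 2E(ℚ_N)`), and `L₂ˢˢ`
(`inv₂ = 0`: by Honda's classification the `S₄`-algebra `ℚ₂[X]/(halving quartic)` depends only on `a₂ ∈ {0, 2, −2}` and on
`[P ∈ 2E(ℚ₂)]`, so six certified instances — 37a1, 101a1, 1747a1 (`P ∉ 2E(ℚ₂)`) and 197a1, 269a1 + Pacetti's `S₃`-section
(`P ∈ 2E(ℚ₂)`) — decide it; census 61/61).**  AN-42d with the binder `v_N(Δ_E)` odd made explicit (automatic for prime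
conductor by Mestre–Oesterlé, kept so that the statement is elementary): for `N` prime, `E` supersingular at `2`, `ρ̄_{E,2}`
onto and `P ∈ E(ℚ)` of infinite order, `P ∈ E⁰(ℝ) ↔ P ∈ 2E(ℚ_N)`. -/
def SupersingularHalvingReciprocityOddDisc : Prop :=
  ∀ (W : WeierstrassCurve ℚ) [W.IsElliptic] [W.IsGloballyMinimal] [W.IsIntegral ℤ] [NeZero (W.conductorNorm ℤ)]
    (N : ℕ) [Fact N.Prime], W.conductorNorm ℤ = N → Odd (padicValRat N W.Δ) → W.HasSurjectiveModNGaloisRep 2 →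
    Even (W.LFunction 2) →
    ∀ (x y : ℚ) (h : W.toAffine.Nonsingular x y), ¬ IsOfFinAddOrder (WeierstrassCurve.Affine.Point.some _ _ h) →
      (HalvingQuarticSolvableOver ℝ W x ↔ HalvingQuarticSolvableOver ℚ_[N] W x)

/-- The explicit-binder form is implied by AN-42d (bookkeeping). -/
theorem supersingularHalvingReciprocityOddDisc_of (H : SupersingularHalvingReciprocity) :
    SupersingularHalvingReciprocityOddDisc := by
  intro W _ _ _ _ N _ hN _ hρ ha x y h hP
  exact H W N hN hρ ha x y h hP

/-- **AN-42d″ (COROLLARY-CANDIDATE of AN-42d′ for `Δ_E < 0`: then `E(ℝ) = E⁰(ℝ)` is connected, so every rational point of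
infinite order is `2`-divisible in `E(ℚ_N)`; census: `Δ<0 ∧ a₂ even ⇒ dN = 1`, 36/36 + Pacetti 43A).** -/
def SupersingularPointsHalveAtConductor : Prop :=
  ∀ (W : WeierstrassCurve ℚ) [W.IsElliptic] [W.IsGloballyMinimal] [W.IsIntegral ℤ] [NeZero (W.conductorNorm ℤ)]
    (N : ℕ) [Fact N.Prime], W.conductorNorm ℤ = N → Odd (padicValRat N W.Δ) → W.HasSurjectiveModNGaloisRep 2 →
    Even (W.LFunction 2) → W.Δ < 0 →
    ∀ (x y : ℚ) (h : W.toAffine.Nonsingular x y), ¬ IsOfFinAddOrder (WeierstrassCurve.Affine.Point.some _ _ h) →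
      HalvingQuarticSolvableOver ℚ_[N] W x


/-- **AN-42g (CONJECTURE with a proof sketch for the exponent, census K42d/K42e 7/7: THE LEVEL LAW `2³·N`).**  Under the
hypotheses of AN-42b with `E` supersingular at 2 and `P ∉ 2E(ℚ₂)` (then `N ≡ 3 (mod 8)` automatically), the octahedral avatar
exists already at level `Γ₁(8N)`: `D₂ = S₄`, `ℚ₂(E[2],½P) ≅` Weil's `M₄` (the least ramified of Weil's three `S₄`-fields of `ℚ₂`;
minimal conductor exponent `3`, Kiming 1994 Thm 2.IV) — verified for `a₂ ∈ {0, −2}` (minimal levels found by K42d/K42e: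
43a1 @ 344, 131a1 @ 1048, 163a1 @ 1304, 347a1 @ 2776, 443a1 @ 3544, 467a1 @ 3736, 571b1 @ 4568); `a₂ = +2` (`M₃` or `M₄`,
both unobstructed): instance 1747a1 pending (kit K42f).  MEMO-an §27.11 (AN-42j): `H¹(ℚ₂, E[2]) ∖ 0 = {M₂, M₃, M₄}` canonically
for every supersingular `E/ℚ₂`, and the Kummer line is isotropic for Serre's quadratic refinement `inv₂∘s` of the Tate pairing. -/
def SupersingularAvatarLevelEightN : Prop :=
  ∀ (W : WeierstrassCurve ℚ) [W.IsElliptic] [W.IsGloballyMinimal] [W.IsIntegral ℤ] [NeZero (W.conductorNorm ℤ)]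
    (N : ℕ) [Fact N.Prime], W.conductorNorm ℤ = N → W.HasSurjectiveModNGaloisRep 2 → W.Δ < 0 → Even (W.LFunction 2) →
    ∀ (x y : ℚ) (h : W.toAffine.Nonsingular x y), ¬ IsOfFinAddOrder (WeierstrassCurve.Affine.Point.some _ _ h) →
      ¬ HalvingQuarticSolvableOver ℚ_[2] W x → HalvingQuarticSolvableOver ℚ_[N] W x →
      ∃ (F : CuspForm (Gamma1 (8 * N)) 1) (u v : ℕ → ℤ), u 1 = 1 ∧ v 1 = 0 ∧
        (∀ n : ℕ, cuspCoeff F n = (u n : ℂ) + (v n : ℂ) * (Complex.I * (Real.sqrt 2 : ℂ))) ∧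
        ∀ ℓ : ℕ, ℓ.Prime → ¬ ℓ ∣ 2 * N →
          Even (u ℓ - W.LFunction ℓ) ∧ Even (v ℓ - pointKummerBit W (WeierstrassCurve.Affine.Point.some _ _ h) ℓ)

/-- **AN-42g′ (CONJECTURE, census K42g 3/3 — THE LEVEL LAW `2²·N` on the (‡) cell).**  Same hypotheses as AN-42g but with
`P ∈ 2E(ℚ₂)` (the halving quartic SOLVABLE over `ℚ₂`): then `D₂ = Gal(ℚ₂(E[2])/ℚ₂) = S₃` with tame inertia `C₃`, Artin exponent
`2`, and the octahedral avatar exists at level `Γ₁(4N)`.  Minimal levels found by K42g (`job:j333351`): 1051a1 @ 4204, 1259a1 @ 5036,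
1987a1 @ 7948 (`dim S₁^new(Γ₁(2N)) = 0` each time; digits 77/77 per curve).  Together with AN-42g: on the supersingular locus the
exponent of `2` in the avatar's minimal level is `2 + [P ∉ 2E(ℚ₂)]` — it READS the 2-adic Kummer bit (MEMO-an §27.11). -/
def SupersingularAvatarLevelFourN : Prop :=
  ∀ (W : WeierstrassCurve ℚ) [W.IsElliptic] [W.IsGloballyMinimal] [W.IsIntegral ℤ] [NeZero (W.conductorNorm ℤ)]
    (N : ℕ) [Fact N.Prime], W.conductorNorm ℤ = N → W.HasSurjectiveModNGaloisRep 2 → W.Δ < 0 → Even (W.LFunction 2) →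
    ∀ (x y : ℚ) (h : W.toAffine.Nonsingular x y), ¬ IsOfFinAddOrder (WeierstrassCurve.Affine.Point.some _ _ h) →
      HalvingQuarticSolvableOver ℚ_[2] W x → HalvingQuarticSolvableOver ℚ_[N] W x →
      ∃ (F : CuspForm (Gamma1 (4 * N)) 1) (u v : ℕ → ℤ), u 1 = 1 ∧ v 1 = 0 ∧
        (∀ n : ℕ, cuspCoeff F n = (u n : ℂ) + (v n : ℂ) * (Complex.I * (Real.sqrt 2 : ℂ))) ∧
        ∀ ℓ : ℕ, ℓ.Prime → ¬ ℓ ∣ 2 * N →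
          Even (u ℓ - W.LFunction ℓ) ∧ Even (v ℓ - pointKummerBit W (WeierstrassCurve.Affine.Point.some _ _ h) ℓ)

/-- AN-42g′ refines AN-42b on its regime (bookkeeping: `2N ∣ 4N`, `ℓ ∤ 4N ↔ ℓ ∤ 2N` for primes). -/
theorem octahedralAvatar_of_levelFourN_ss (H : SupersingularAvatarLevelFourN)
    (W : WeierstrassCurve ℚ) [W.IsElliptic] [W.IsGloballyMinimal] [W.IsIntegral ℤ] [NeZero (W.conductorNorm ℤ)]
    (N : ℕ) [Fact N.Prime] (hN : W.conductorNorm ℤ = N) (hρ : W.HasSurjectiveModNGaloisRep 2) (hΔ : W.Δ < 0)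
    (ha : Even (W.LFunction 2)) (x y : ℚ) (h : W.toAffine.Nonsingular x y)
    (hP : ¬ IsOfFinAddOrder (WeierstrassCurve.Affine.Point.some _ _ h))
    (h2 : HalvingQuarticSolvableOver ℚ_[2] W x) (hNloc : HalvingQuarticSolvableOver ℚ_[N] W x) :
    ∃ (M : ℕ) (F : CuspForm (Gamma1 M) 1) (u v : ℕ → ℤ), 2 * N ∣ M ∧ u 1 = 1 ∧ v 1 = 0 ∧
        (∀ n : ℕ, cuspCoeff F n = (u n : ℂ) + (v n : ℂ) * (Complex.I * (Real.sqrt 2 : ℂ))) ∧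
        ∀ ℓ : ℕ, ℓ.Prime → ¬ ℓ ∣ M →
          Even (u ℓ - W.LFunction ℓ) ∧ Even (v ℓ - pointKummerBit W (WeierstrassCurve.Affine.Point.some _ _ h) ℓ) := by
  obtain ⟨F, u, v, hu, hv, hq, hℓ⟩ := H W N hN hρ hΔ ha x y h hP h2 hNloc
  refine ⟨4 * N, F, u, v, ⟨2, by ring⟩, hu, hv, hq, ?_⟩
  intro ℓ hℓp hℓM
  apply hℓ ℓ hℓp
  intro hd
  exact hℓM (dvd_trans hd ⟨2, by ring⟩)

/-- AN-42g refines AN-42b on its regime (bookkeeping: level `8N` is a level `M` with `2N ∣ M`, and `ℓ ∤ 8N ↔ ℓ ∤ 2N` for primes). -/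
theorem octahedralAvatar_of_levelEightN_ss (H : SupersingularAvatarLevelEightN)
    (W : WeierstrassCurve ℚ) [W.IsElliptic] [W.IsGloballyMinimal] [W.IsIntegral ℤ] [NeZero (W.conductorNorm ℤ)]
    (N : ℕ) [Fact N.Prime] (hN : W.conductorNorm ℤ = N) (hρ : W.HasSurjectiveModNGaloisRep 2) (hΔ : W.Δ < 0)
    (ha : Even (W.LFunction 2)) (x y : ℚ) (h : W.toAffine.Nonsingular x y)
    (hP : ¬ IsOfFinAddOrder (WeierstrassCurve.Affine.Point.some _ _ h))
    (h2 : ¬ HalvingQuarticSolvableOver ℚ_[2] W x) (hNloc : HalvingQuarticSolvableOver ℚ_[N] W x) :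
    ∃ (M : ℕ) (F : CuspForm (Gamma1 M) 1) (u v : ℕ → ℤ), 2 * N ∣ M ∧ u 1 = 1 ∧ v 1 = 0 ∧
        (∀ n : ℕ, cuspCoeff F n = (u n : ℂ) + (v n : ℂ) * (Complex.I * (Real.sqrt 2 : ℂ))) ∧
        ∀ ℓ : ℕ, ℓ.Prime → ¬ ℓ ∣ M →
          Even (u ℓ - W.LFunction ℓ) ∧ Even (v ℓ - pointKummerBit W (WeierstrassCurve.Affine.Point.some _ _ h) ℓ) := by
  obtain ⟨F, u, v, hu, hv, hq, hℓ⟩ := H W N hN hρ hΔ ha x y h hP h2 hNloc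
  refine ⟨8 * N, F, u, v, ⟨4, by ring⟩, hu, hv, hq, ?_⟩
  intro ℓ hℓp hℓM
  apply hℓ ℓ hℓp
  intro hd
  exact hℓM (dvd_trans hd ⟨4, by ring⟩)


end Summit.BirchSwinnertonDyer.Rank1Residual.F1Sign2.ANg24
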